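import Summits.ABC.IUTFork.Thm311RealInd1StripPacketThetaJunctionBit
import Summits.ABC.IUTFork.Thm311RealInd1StripPacketUnionJunctionResidue
import HarnessLib

/-!
# [IUTchIII] Thm 3.11 (i) (Ind1)+(Ind2) ⟶ Cor 3.12, reading (U): the UNION junction with the residue-degree hypothesis REPLACED by the depth-`e`
# BIT (modulo `JannsenWingbergMappingClass`) — packet, place-section, `ln ν̄_{𝕃_p}` and input levels

PROOF-ONLY file (abc-iut cell, Cor. 3.12 sub-crew, seat abc-iut-c312-1 = holder of record of the typed [IUTchIII] Thm. 3.11, gen 18; row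
«R24 = C:F1-DEPTH-E-DICHOTOMY», KEY F1DICHOTOMY, C LEAD ruling C-R152 (f); file 5 of the row — the reading-(U) twin of file 4
`Thm311RealInd1StripPacketThetaJunctionBit`).  TAKES NO SIDE on [IUTchIII] Cor. 3.12.  No definition, no `Prop` fact; `JannsenWingbergMappingClass`
is the only conditional input (binder `hMC`); the depth-`e` bit enters as ONE displayed binder per factor of residue degree one (`hbit`).  The R23
theorems (p546301 / p547431) stay as landed; the new theorems carry the bit IN PLACE OF their residue hypotheses `hres` / `hram`+`hmin`.

* §1 packet level **`packetHull_iUnion_image_iUnion_iota_smul_normalizedPacket_eq_of_bit_of_jannsenWingbergMappingClass`** — R23's `…_of_residue_…`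
  (p546301 §1) at a named content-minimising slot `a₀` with `hres` replaced by `hbit : ∀ i, f(w_i|p) = 1 → (i = a₀ → e_{a₀} ∣ v_{a₀}) → (the bit
  at w_i)`; the lower bound is file 4's packet junction under the bit at the slot `a₀`, the upper bound p545184's content of the slot union.
* §2 place-section level **`localFields_packetHull_orbitH_indOneUnion_pilotRegion_eq_possibleImagesHull_of_bit_of_jannsenWingbergMappingClass`** —
  the `(R_I)^∼`-hull of the `H`-orbit of the (Ind1)-slot union of `O_𝕃(−P_Θ)` EQUALS `possibleImagesHull`, the bit displayed at the factors of
  residue degree one (at `a₀` only when `e(v̲_{a₀}|p) ∣ v_{a₀}`).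
* §3 `ln ν̄_{𝕃_p}` level **`localFields_lnνLp_hull_orbitH_indOneUnion_eq_negLogThetaAt_of_bit_of_jannsenWingbergMappingClass`** (= `negLogThetaAt`,
  READING (U), the cell's reading of record) and §4 input level **`ThetaVolumeInput.lnνLp_hull_orbitH_indOneUnion_eq_negLogThetaLoc_of_bit_…`**
  under the per-collection bit family.  R23's `hram`/`hmin` imply the bit family vacuously (file 4 `bit_of_residue` per collection).
READING (numbers about OUR typed objects; neutral): as for file 4 — the (U)-junction of gens 16–17 now rests, at each place of residue degree one,
on ONE displayed bit of the realised strip group (both single-place branches computed in files 1–2, p550084 / p550723); nothing here decides any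
bit; the packet-level hull when a bit FAILS is not computed here.  HONEST SCOPE as in R23: OUR typings (THE equivariant lift, THE logarithm,
factorwise action; F-B28-1 untouched); conditional on `hMC`; EVEN local degree (NOT typed), WILD, `p = 2` remain; equal-AS-TYPED ≠ equal in print;
no side taken on (U) vs (P), on [IUTchIII] Cor. 3.12 / [IUTchIV] Thm. 1.10 or on any author; nothing here asserts that abc is proved or refuted.
[claim: Mochizuki2012, status: disputed]; [cite: Mochizuki2012, IUTchIII Thm. 3.11 (i) p. 154; Cor. 3.12 p. 174; IUTchIV Prop. 1.2 (ii) pp. 10–11];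
[cite: Kondo2025OuterAutMLF, §3 Thm 3.17, Rem 3.18; p. 5]; [cite: DupuyHilado2025, §4.7, §4.9, §4.11, §4.12]. typed ≠ proved; a conditional theorem
discharges nothing it binds.
-/

set_option autoImplicit false

noncomputable section

open Metric Set Function
open scoped Pointwise TensorProduct

namespace Summit.ABC.IUTFork.Thm311.Real

open NumberField IsDedekindDomain Literature.NumberTheory.NumberFields Literature.IUT.LogVolume
open Literature.NumberTheory.GaloisRepresentations Literature.NumberTheory.GaloisRepresentations.Ultrametric
open Literature.AnabelianGeometry.AbsoluteAnabelian Literature.IUT.HodgeArakelov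
open Literature.IUT.HodgeArakelov.AbsTopMonoids

/-! ## §1 Packet level: the `H`-orbit of the slot union under the depth-`e` bit -/

section GenuineFactors

variable {K : Type} [Field K] [NumberField K] (p : ℕ) [hp : Fact p.Prime]
variable {I : Type} [Fintype I] [DecidableEq I] (w : I → HeightOneSpectrum (𝓞 K)) (hw : ∀ i, ((p : ℕ) : 𝓞 K) ∈ (w i).asIdeal)

/-- **THE UNION JUNCTION at the packet under the DEPTH-`e` BIT (modulo `JannsenWingbergMappingClass`).**  Setting of R23's
`packetHull_iUnion_image_iUnion_iota_smul_normalizedPacket_eq_of_residue_of_jannsenWingbergMappingClass` (p546301): every factor TAME of ODD local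
degree `≥ 3`, slot twists `‖g_a‖ = p^{−v_a/e_a}`, a content-minimising slot `a₀`; the residue hypothesis `hres` REPLACED by the bit: at every factor
`i` of residue degree one — at `i = a₀` only when `e_{a₀} ∣ v_{a₀}` — some realised strip automorphism at `w_i` moves `ℤ_p·p` modulo
`p·log_p(𝒪_{w_i}^×)`.  For every `H ≤ indTwo` containing the single-factor strip moves: `packetHull(⋃_{γ∈H} γ(⋃_a ι_a(g_a)·(R_I)^∼)) =
packetHull(p^{min_a A_a}·log_p(R_I^×))` (upper: the content of the slot union, p545184; lower: file 4's junction under the bit at the slot `a₀`).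
[claim: Mochizuki2012, status: disputed] [cite: Mochizuki2012, IUTchIII Thm. 3.11 (i) p. 154; Cor. 3.12 p. 174; IUTchIV Prop. 1.2 (ii) p. 10–11]
[cite: Kondo2025OuterAutMLF, §3 Thm 3.17, Rem 3.18] [cite: DupuyHilado2025, §4.7, §4.9, §4.12] -/
theorem packetHull_iUnion_image_iUnion_iota_smul_normalizedPacket_eq_of_bit_of_jannsenWingbergMappingClass [Nonempty I]
    (hMC : JannsenWingbergMappingClass) (hp2 : 2 < p)
    (he : ∀ i, absRamificationIdx p (RescaledCompletion K p (w i) (hw i)) ≤ p - 2)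
    (h3 : ∀ i, 3 ≤ localDeg K (w i)) (hodd : ∀ i, Odd (localDeg K (w i)))
    (g : Π i, RescaledCompletion K p (w i) (hw i)) (v : I → ℤ)
    (hg : ∀ i, ‖g i‖ = (p : ℝ) ^ (-(v i / (absRamificationIdx p (RescaledCompletion K p (w i) (hw i)) : ℝ))))
    (a₀ : I)
    (ha₀ : ∀ a, (v a₀ - 1) / (absRamificationIdx p (RescaledCompletion K p (w a₀) (hw a₀)) : ℤ) ≤
      (v a - 1) / (absRamificationIdx p (RescaledCompletion K p (w a) (hw a)) : ℤ))
    (hbit : ∀ i, (w i).asIdeal.inertiaDeg ℤ = 1 →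
      (i = a₀ → ((absRamificationIdx p (RescaledCompletion K p (w a₀) (hw a₀)) : ℤ) ∣ v a₀)) →
      ∃ ψ ∈ ind1StripOf (w i) (galoisLog (w i)),
        RescaledCompletion.of K p (w i) (hw i) (ψ (p : (w i).adicCompletion K)) - (p : RescaledCompletion K p (w i) (hw i)) ∉
          (p : ℚ_[p]) • logUnits (RescaledCompletion K p (w i) (hw i)))
    (H : Subgroup (PacketAlgebra p (fun i => RescaledCompletion K p (w i) (hw i)) ≃ₗ[ℚ_[p]]
      PacketAlgebra p (fun i => RescaledCompletion K p (w i) (hw i))))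
    (hH : H ≤ indTwo p (fun i => RescaledCompletion K p (w i) (hw i)))
    (hstrip : ∀ (i₁ : I), ∀ ψ ∈ ind1StripOf (w i₁) (galoisLog (w i₁)), ∃ γ ∈ H,
      ∀ z : Π i, RescaledCompletion K p (w i) (hw i),
        (γ : PacketAlgebra p (fun i => RescaledCompletion K p (w i) (hw i)) ≃ₗ[ℚ_[p]]
            PacketAlgebra p (fun i => RescaledCompletion K p (w i) (hw i))) (PiTensorProduct.tprod ℚ_[p] z) =
          PiTensorProduct.tprod ℚ_[p] (update z i₁ (RescaledCompletion.of K p (w i₁) (hw i₁)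
            (ψ ((RescaledCompletion.of K p (w i₁) (hw i₁)).symm (z i₁)))))) :
    packetHull p (fun i => RescaledCompletion K p (w i) (hw i))
        (⋃ γ : H, (γ : PacketAlgebra p (fun i => RescaledCompletion K p (w i) (hw i)) ≃ₗ[ℚ_[p]]
            PacketAlgebra p (fun i => RescaledCompletion K p (w i) (hw i))) ''
          ⋃ a, iota p (fun i => RescaledCompletion K p (w i) (hw i)) a (g a) •
            (normalizedPacket p (fun i => RescaledCompletion K p (w i) (hw i)) :
              Set (PacketAlgebra p (fun i => RescaledCompletion K p (w i) (hw i))))) =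
      packetHull p (fun i => RescaledCompletion K p (w i) (hw i))
        (((p : ℚ_[p]) ^ (Finset.univ.inf' Finset.univ_nonempty
            (fun a => (v a - 1) / (absRamificationIdx p (RescaledCompletion K p (w a) (hw a)) : ℤ) + 1 - Fintype.card I))) •
          (logPacket p (fun i => RescaledCompletion K p (w i) (hw i)) :
            Set (PacketAlgebra p (fun i => RescaledCompletion K p (w i) (hw i))))) := by
  set k := fun i => RescaledCompletion K p (w i) (hw i) with hk
  set A : I → ℤ := fun a => (v a - 1) / (absRamificationIdx p (k a) : ℤ) + 1 - Fintype.card I with hA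
  obtain ⟨hsub, -⟩ := TameContent.content_iUnion_iota_smul_normalizedPacket p k hp2 he g v hg
  refine Set.Subset.antisymm (packetHull_iUnion_image_subset_of_subset_smul_logPacket p k hsub H hH) ?_
  -- the named slot `a₀` attains the minimum content
  have hmin : Finset.univ.inf' Finset.univ_nonempty A = A a₀ :=
    le_antisymm (Finset.inf'_le A (Finset.mem_univ a₀))
      (Finset.le_inf' Finset.univ_nonempty A fun a _ => by
        have := ha₀ a
        simp only [hA]
        linarith)
  have hcore := packetHull_iUnion_image_iota_smul_normalizedPacket_eq_of_bit_of_jannsenWingbergMappingClass p w hw hMC hp2 he h3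
    hodd a₀ (hg a₀) hbit H hH hstrip
  change packetHull p k (((p : ℚ_[p]) ^ (Finset.univ.inf' Finset.univ_nonempty A)) • (logPacket p k : Set (PacketAlgebra p k))) ⊆ _
  rw [hmin, ← hcore]
  refine packetHull_mono p k (Set.iUnion_mono fun γ => Set.image_mono ?_)
  exact Set.subset_iUnion (fun a => iota p k a (g a) • (normalizedPacket p k : Set (PacketAlgebra p k))) a₀

end GenuineFactors

/-! ## §2 Place-section level: the `H`-orbit of the (Ind1)-slot union under the depth-`e` bit -/

section PlaceSection

variable {F₀ : Type} [Field F₀] [NumberField F₀] {K : Type} [Field K] [NumberField K] [Algebra F₀ K]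
variable (σ : PlaceSection F₀ K) (p : ℕ) [hp : Fact p.Prime]
variable (c : (j : ℕ) → (Fin (j + 1) → placesOver F₀ p) → ℚ_[p]) (hc0 : ∀ j e, c j e ≠ 0)
  (hcσ : ∀ (j : ℕ) (τ : Equiv.Perm (Fin (j + 1))) (e : Fin (j + 1) → placesOver F₀ p), c j (e ∘ τ) = c j e)

/-- **THE UNION JUNCTION under the DEPTH-`e` BIT, place-section level (modulo `JannsenWingbergMappingClass`).**  Setting of R23's
`localFields_packetHull_orbitH_indOneUnion_pilotRegion_eq_possibleImagesHull_of_residue_of_jannsenWingbergMappingClass` (p546301 §2: collection `v⃗`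
with every factor tame of odd local degree `≥ 3`, slot valuations `‖t_{i,v_a}‖ = p^{−v_a/e(v̲_a|p)}`, content-minimising slot `a₀`, `H ≤ indTwo`
containing the single-factor (Ind1) strip moves); `hram`/`hmin` REPLACED by the bit at the factors of residue degree one (at `a₀` only when
`e(v̲_{a₀}|p) ∣ v_{a₀}`).  Same conclusion: the `(R_I)^∼`-hull of the `H`-orbit of the (Ind1)-slot union EQUALS the hull of ALL possible images.
[claim: Mochizuki2012, status: disputed] [cite: Mochizuki2012, IUTchIII Thm. 3.11 (i) p. 154; Cor. 3.12 p. 174; IUTchIV Prop. 1.2 (ii) p. 10–11]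
[cite: Kondo2025OuterAutMLF, §3 Thm 3.17, Rem 3.18] [cite: DupuyHilado2025, §4.7, §4.9, §4.11, §4.12] -/
theorem localFields_packetHull_orbitH_indOneUnion_pilotRegion_eq_possibleImagesHull_of_bit_of_jannsenWingbergMappingClass
    (hMC : JannsenWingbergMappingClass) (hp2 : 2 < p) {lstar : ℕ}
    (t : Fin lstar → (v : placesOver F₀ p) → ((σ.localFields p).k v)ˣ) (i : Fin lstar)
    (e : Fin ((i : ℕ) + 1 + 1) → placesOver F₀ p)
    (he : ∀ b, absRamificationIdx p ((σ.localFields p).k (e b)) ≤ p - 2)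
    (h3 : ∀ b, 3 ≤ localDeg K (σ.lift (e b).1)) (hodd : ∀ b, Odd (localDeg K (σ.lift (e b).1)))
    (v : Fin ((i : ℕ) + 1 + 1) → ℤ)
    (hv : ∀ a, ‖(t i (e a) : (σ.localFields p).k (e a))‖ =
      (p : ℝ) ^ (-(v a / (absRamificationIdx p ((σ.localFields p).k (e a)) : ℝ))))
    (a₀ : Fin ((i : ℕ) + 1 + 1))
    (ha₀ : ∀ a, (v a₀ - 1) / (absRamificationIdx p ((σ.localFields p).k (e a₀)) : ℤ) ≤
      (v a - 1) / (absRamificationIdx p ((σ.localFields p).k (e a)) : ℤ))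
    (hbit : ∀ b, (σ.lift (e b).1).asIdeal.inertiaDeg ℤ = 1 →
      (b = a₀ → ((absRamificationIdx p ((σ.localFields p).k (e a₀)) : ℤ) ∣ v a₀)) →
      ∃ ψ ∈ ind1StripOf (σ.lift (e b).1) (galoisLog (σ.lift (e b).1)),
        RescaledCompletion.of K p (σ.lift (e b).1) (σ.natCast_mem_lift (e b)) (ψ (p : (σ.lift (e b).1).adicCompletion K)) -
            (p : RescaledCompletion K p (σ.lift (e b).1) (σ.natCast_mem_lift (e b))) ∉
          (p : ℚ_[p]) • logUnits (RescaledCompletion K p (σ.lift (e b).1) (σ.natCast_mem_lift (e b))))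
    (H : Subgroup (PacketAlgebra p (fun b => (σ.localFields p).k (e b)) ≃ₗ[ℚ_[p]]
      PacketAlgebra p (fun b => (σ.localFields p).k (e b))))
    (hH : H ≤ indTwo p (fun b => (σ.localFields p).k (e b)))
    (hstrip : ∀ (b₀ : Fin ((i : ℕ) + 1 + 1)),
      ∀ ψ ∈ ind1StripOf (σ.lift (e b₀).1) (galoisLog (σ.lift (e b₀).1)), ∃ γ ∈ H,
        ∀ z : ∀ b, (σ.localFields p).k (e b),
          (γ : PacketAlgebra p (fun b => (σ.localFields p).k (e b)) ≃ₗ[ℚ_[p]]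
              PacketAlgebra p (fun b => (σ.localFields p).k (e b))) (PiTensorProduct.tprod ℚ_[p] z) =
            PiTensorProduct.tprod ℚ_[p] (update z b₀
              (RescaledCompletion.of K p (σ.lift (e b₀).1) (σ.natCast_mem_lift (e b₀))
                (ψ ((RescaledCompletion.of K p (σ.lift (e b₀).1) (σ.natCast_mem_lift (e b₀))).symm (z b₀)))))) :
    packetHull p (fun b => (σ.localFields p).k (e b))
        (⋃ γ : H, (γ : PacketAlgebra p (fun b => (σ.localFields p).k (e b)) ≃ₗ[ℚ_[p]]
            PacketAlgebra p (fun b => (σ.localFields p).k (e b))) ''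
          ⋃ τ : Equiv.Perm (Fin ((i : ℕ) + 1 + 1)), (realPrimePacketWith p (σ.localFields p) c hc0 hcσ).perm τ e ''
            (realPrimePacketWith p (σ.localFields p) c hc0 hcσ).pilotRegion t ((i : ℕ) + 1) (e ∘ τ)) =
      (realPrimePacketWith p (σ.localFields p) c hc0 hcσ).possibleImagesHull
        ((realPrimePacketWith p (σ.localFields p) c hc0 hcσ).pilotRegion t) ((i : ℕ) + 1) e := by
  have hcore := packetHull_iUnion_image_iUnion_iota_smul_normalizedPacket_eq_of_bit_of_jannsenWingbergMappingClass p
    (fun b => σ.lift (e b).1) (fun b => σ.natCast_mem_lift (e b)) hMC hp2 he h3 hodd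
    (fun a => (t i (e a) : (σ.localFields p).k (e a))) v hv a₀ ha₀ hbit H hH hstrip
  have hcont := TameContent.packetHull_orbit_iUnion_iota_smul_normalizedPacket_eq p (fun b => (σ.localFields p).k (e b)) hp2 he
    (fun a => (t i (e a) : (σ.localFields p).k (e a))) v hv
  have hU : (⋃ τ : Equiv.Perm (Fin ((i : ℕ) + 1 + 1)),
      ((realPrimePacketWith p (σ.localFields p) c hc0 hcσ).perm τ e ''
          (realPrimePacketWith p (σ.localFields p) c hc0 hcσ).pilotRegion t ((i : ℕ) + 1) (e ∘ τ) :
        Set (PacketAlgebra p (fun b => (σ.localFields p).k (e b))))) =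
      ⋃ a : Fin ((i : ℕ) + 1 + 1), iota p (fun b => (σ.localFields p).k (e b)) a (t i (e a) : (σ.localFields p).k (e a)) •
        (normalizedPacket p (fun b => (σ.localFields p).k (e b)) : Set (PacketAlgebra p (fun b => (σ.localFields p).k (e b)))) :=
    realPrimePacketWith_indOneUnion_pilotRegion_eq_slotUnion p (σ.localFields p) c hc0 hcσ t i e
  change packetHull p _ (⋃ γ : H, (γ : PacketAlgebra p (fun b => (σ.localFields p).k (e b)) ≃ₗ[ℚ_[p]]
      PacketAlgebra p (fun b => (σ.localFields p).k (e b))) '' ⋃ τ : Equiv.Perm (Fin ((i : ℕ) + 1 + 1)),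
      ((realPrimePacketWith p (σ.localFields p) c hc0 hcσ).perm τ e ''
          (realPrimePacketWith p (σ.localFields p) c hc0 hcσ).pilotRegion t ((i : ℕ) + 1) (e ∘ τ) :
        Set (PacketAlgebra p (fun b => (σ.localFields p).k (e b))))) =
    packetHull p _ ((realPrimePacketWith p (σ.localFields p) c hc0 hcσ).possibleImages _ _ e)
  rw [hU, realPrimePacketWith_possibleImages_pilotRegion_eq]
  exact hcore.trans hcont.symm

/-! ## §3 The `ln ν̄_{𝕃_p}`-level identity with `−|log(Θ)|_p` (reading (U)) under the depth-`e` bit -/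

/-- **READING (U) OVER PRINT's (Ind1)⊔(Ind2) AS TYPED EQUALS `−|log(Θ)|_p`, under the DEPTH-`e` BIT (modulo `JannsenWingbergMappingClass`).**
Setting of p547431 §1 (every `v̲ ∣ p` of the section tame of odd local degree `≥ 3`; slot valuation family `v(i,v⃗,a)`; content-minimising slot family
`a₀(i,v⃗)`); the residue hypotheses `hram`/`hmin` REPLACED by the per-collection bit family `hbit` (a factor of residue degree one needs a base-line
mover, at `a₀(i,v⃗)` only when `e ∣ v(i,v⃗,a₀)`).  Then for any family `H` with `H ≤ indTwo` containing the single-factor strip moves: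
`ln ν̄_{𝕃_p}(v⃗ ↦ hull(⋃_{g ∈ H_{v⃗}} g(⋃_σ σ·O_𝕃(−P_Θ)_{v⃗∘σ}))) = −|log(Θ)|_p` (`negLogThetaAt`). [claim: Mochizuki2012, status: disputed]
[cite: Mochizuki2012, IUTchIII Thm. 3.11 (i) p. 154; Cor. 3.12 p. 174] [cite: Kondo2025OuterAutMLF, §3 Thm 3.17, Rem 3.18]
[cite: DupuyHilado2025, §4.7, §4.9, §4.11, §4.12] -/
theorem localFields_lnνLp_hull_orbitH_indOneUnion_eq_negLogThetaAt_of_bit_of_jannsenWingbergMappingClass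
    (hMC : JannsenWingbergMappingClass) (hp2 : 2 < p) {lstar : ℕ}
    (t : Fin lstar → (v : placesOver F₀ p) → ((σ.localFields p).k v)ˣ)
    (he : ∀ v : placesOver F₀ p, absRamificationIdx p ((σ.localFields p).k v) ≤ p - 2)
    (h3 : ∀ v : placesOver F₀ p, 3 ≤ localDeg K (σ.lift v.1)) (hodd : ∀ v : placesOver F₀ p, Odd (localDeg K (σ.lift v.1)))
    (v : (i : Fin lstar) → (Fin ((i : ℕ) + 1 + 1) → placesOver F₀ p) → Fin ((i : ℕ) + 1 + 1) → ℤ)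
    (hv : ∀ (i : Fin lstar) (e : Fin ((i : ℕ) + 1 + 1) → placesOver F₀ p) (a : Fin ((i : ℕ) + 1 + 1)),
      ‖(t i (e a) : (σ.localFields p).k (e a))‖ =
        (p : ℝ) ^ (-(v i e a / (absRamificationIdx p ((σ.localFields p).k (e a)) : ℝ))))
    (a₀ : (i : Fin lstar) → (Fin ((i : ℕ) + 1 + 1) → placesOver F₀ p) → Fin ((i : ℕ) + 1 + 1))
    (ha₀ : ∀ (i : Fin lstar) (e : Fin ((i : ℕ) + 1 + 1) → placesOver F₀ p) (a : Fin ((i : ℕ) + 1 + 1)),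
      (v i e (a₀ i e) - 1) / (absRamificationIdx p ((σ.localFields p).k (e (a₀ i e))) : ℤ) ≤
        (v i e a - 1) / (absRamificationIdx p ((σ.localFields p).k (e a)) : ℤ))
    (hbit : ∀ (i : Fin lstar) (e : Fin ((i : ℕ) + 1 + 1) → placesOver F₀ p) (b : Fin ((i : ℕ) + 1 + 1)),
      (σ.lift (e b).1).asIdeal.inertiaDeg ℤ = 1 →
        (b = a₀ i e → ((absRamificationIdx p ((σ.localFields p).k (e (a₀ i e))) : ℤ) ∣ v i e (a₀ i e))) →
        ∃ ψ ∈ ind1StripOf (σ.lift (e b).1) (galoisLog (σ.lift (e b).1)),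
          RescaledCompletion.of K p (σ.lift (e b).1) (σ.natCast_mem_lift (e b)) (ψ (p : (σ.lift (e b).1).adicCompletion K)) -
              (p : RescaledCompletion K p (σ.lift (e b).1) (σ.natCast_mem_lift (e b))) ∉
            (p : ℚ_[p]) • logUnits (RescaledCompletion K p (σ.lift (e b).1) (σ.natCast_mem_lift (e b))))
    (H : (j : ℕ) → (e : Fin (j + 1) → placesOver F₀ p) →
      Subgroup (PacketAlgebra p (fun b => (σ.localFields p).k (e b)) ≃ₗ[ℚ_[p]]
        PacketAlgebra p (fun b => (σ.localFields p).k (e b))))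
    (hH : ∀ j e, H j e ≤ indTwo p (fun b => (σ.localFields p).k (e b)))
    (hstrip : ∀ (i : Fin lstar) (e : Fin ((i : ℕ) + 1 + 1) → placesOver F₀ p) (b₀ : Fin ((i : ℕ) + 1 + 1)),
      ∀ ψ ∈ ind1StripOf (σ.lift (e b₀).1) (galoisLog (σ.lift (e b₀).1)), ∃ γ ∈ H ((i : ℕ) + 1) e,
        ∀ z : ∀ b, (σ.localFields p).k (e b),
          (γ : PacketAlgebra p (fun b => (σ.localFields p).k (e b)) ≃ₗ[ℚ_[p]]
              PacketAlgebra p (fun b => (σ.localFields p).k (e b))) (PiTensorProduct.tprod ℚ_[p] z) =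
            PiTensorProduct.tprod ℚ_[p] (update z b₀
              (RescaledCompletion.of K p (σ.lift (e b₀).1) (σ.natCast_mem_lift (e b₀))
                (ψ ((RescaledCompletion.of K p (σ.lift (e b₀).1) (σ.natCast_mem_lift (e b₀))).symm (z b₀)))))) :
    (realPrimePacketWith p (σ.localFields p) c hc0 hcσ).lnνLp lstar (fun j e =>
        packetHull p (fun b => (σ.localFields p).k (e b))
          (⋃ g : H j e, (g : PacketAlgebra p (fun b => (σ.localFields p).k (e b)) ≃ₗ[ℚ_[p]]
              PacketAlgebra p (fun b => (σ.localFields p).k (e b))) ''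
            ⋃ τ : Equiv.Perm (Fin (j + 1)), (realPrimePacketWith p (σ.localFields p) c hc0 hcσ).perm τ e ''
              (realPrimePacketWith p (σ.localFields p) c hc0 hcσ).pilotRegion t j (e ∘ τ))) =
      (realPrimePacketWith p (σ.localFields p) c hc0 hcσ).negLogThetaAt lstar t := by
  unfold PrimePacket.negLogThetaAt
  refine (realPrimePacketWith p (σ.localFields p) c hc0 hcσ).lnνLp_congr_of_succ lstar fun i e => ?_
  exact localFields_packetHull_orbitH_indOneUnion_pilotRegion_eq_possibleImagesHull_of_bit_of_jannsenWingbergMappingClass σ p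
    c hc0 hcσ hMC hp2 t i e (fun b => he (e b)) (fun b => h3 (e b)) (fun b => hodd (e b)) (v i e) (hv i e) (a₀ i e) (ha₀ i e)
    (hbit i e) (H _ e) (hH _ e) (hstrip i e)

end PlaceSection

end Summit.ABC.IUTFork.Thm311.Real

/-! ## §4 Input level: the `p`-summand of `−|log(Θ)|` (reading (U)) of a genuine Θ-volume input, under the depth-`e` bit -/

namespace Literature.IUT.LogVolume.ThetaVolumeInput

open Summit.ABC.IUTFork.Thm311.Real Literature.NumberTheory.NumberFields Function

variable {F₀ : Type} [Field F₀] [NumberField F₀] {K : Type} [Field K] [NumberField K] [Algebra F₀ K]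
variable (I : ThetaVolumeInput F₀ K)

/-- **INPUT LEVEL, reading (U), under the DEPTH-`e` BIT.**  For a genuine Θ-volume input `I` and a prime `p > 2` over which every place of the
section is tame of odd local degree `≥ 3`, with slot valuations `v(i,v⃗,a)` of `t_Θ`, a content-minimising slot family `a₀(i,v⃗)`, and the bit at
every factor of residue degree one (at `a₀(i,v⃗)` only when `e ∣ v(i,v⃗,a₀)`): the `p`-summand of `−|log(Θ)|` (`negLogThetaLoc I p`, reading (U))
EQUALS the reading computed over any family `H` of subgroups of the packet automorphisms with `H ≤ indTwo` containing the single-factor (Ind1)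
strip moves — modulo `JannsenWingbergMappingClass`. [claim: Mochizuki2012, status: disputed] [cite: Mochizuki2012, IUTchIII Cor. 3.12 p. 174]
[cite: DupuyHilado2025, §4.11, §4.12] -/
theorem lnνLp_hull_orbitH_indOneUnion_eq_negLogThetaLoc_of_bit_of_jannsenWingbergMappingClass
    (hMC : Literature.AnabelianGeometry.AbsoluteAnabelian.JannsenWingbergMappingClass) {p : ℕ} (hp : p.Prime) (hp2 : 2 < p)
    (he : haveI : Fact p.Prime := ⟨hp⟩; ∀ v : placesOver F₀ p, absRamificationIdx p ((I.σ.localFields p).k v) ≤ p - 2)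
    (h3 : haveI : Fact p.Prime := ⟨hp⟩; ∀ v : placesOver F₀ p, 3 ≤ localDeg K (I.σ.lift v.1))
    (hodd : haveI : Fact p.Prime := ⟨hp⟩; ∀ v : placesOver F₀ p, Odd (localDeg K (I.σ.lift v.1)))
    (v : haveI : Fact p.Prime := ⟨hp⟩; (i : Fin I.lstar) → (Fin ((i : ℕ) + 1 + 1) → placesOver F₀ p) → Fin ((i : ℕ) + 1 + 1) → ℤ)
    (hv : haveI : Fact p.Prime := ⟨hp⟩; ∀ (i : Fin I.lstar) (e : Fin ((i : ℕ) + 1 + 1) → placesOver F₀ p) (a : Fin ((i : ℕ) + 1 + 1)),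
      ‖(I.tΘ p hp i (e a) : (I.σ.localFieldFamily p hp).k (e a))‖ =
        (p : ℝ) ^ (-(v i e a / (absRamificationIdx p ((I.σ.localFieldFamily p hp).k (e a)) : ℝ))))
    (a₀ : haveI : Fact p.Prime := ⟨hp⟩; (i : Fin I.lstar) → (Fin ((i : ℕ) + 1 + 1) → placesOver F₀ p) → Fin ((i : ℕ) + 1 + 1))
    (ha₀ : haveI : Fact p.Prime := ⟨hp⟩; ∀ (i : Fin I.lstar) (e : Fin ((i : ℕ) + 1 + 1) → placesOver F₀ p) (a : Fin ((i : ℕ) + 1 + 1)),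
      (v i e (a₀ i e) - 1) / (absRamificationIdx p ((I.σ.localFields p).k (e (a₀ i e))) : ℤ) ≤
        (v i e a - 1) / (absRamificationIdx p ((I.σ.localFields p).k (e a)) : ℤ))
    (hbit : haveI : Fact p.Prime := ⟨hp⟩; ∀ (i : Fin I.lstar) (e : Fin ((i : ℕ) + 1 + 1) → placesOver F₀ p) (b : Fin ((i : ℕ) + 1 + 1)),
      (I.σ.lift (e b).1).asIdeal.inertiaDeg ℤ = 1 →
        (b = a₀ i e → ((absRamificationIdx p ((I.σ.localFields p).k (e (a₀ i e))) : ℤ) ∣ v i e (a₀ i e))) →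
        ∃ ψ ∈ ind1StripOf (I.σ.lift (e b).1) (galoisLog (I.σ.lift (e b).1)),
          RescaledCompletion.of K p (I.σ.lift (e b).1) (I.σ.natCast_mem_lift (e b)) (ψ (p : (I.σ.lift (e b).1).adicCompletion K)) -
              (p : RescaledCompletion K p (I.σ.lift (e b).1) (I.σ.natCast_mem_lift (e b))) ∉
            (p : ℚ_[p]) • logUnits (RescaledCompletion K p (I.σ.lift (e b).1) (I.σ.natCast_mem_lift (e b))))
    (H : haveI : Fact p.Prime := ⟨hp⟩
      (j : ℕ) → (e : Fin (j + 1) → placesOver F₀ p) →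
        Subgroup (PacketAlgebra p (fun b => (I.σ.localFields p).k (e b)) ≃ₗ[ℚ_[p]]
          PacketAlgebra p (fun b => (I.σ.localFields p).k (e b))))
    (hH : haveI : Fact p.Prime := ⟨hp⟩; ∀ j e, H j e ≤ indTwo p (fun b => (I.σ.localFields p).k (e b)))
    (hstrip : haveI : Fact p.Prime := ⟨hp⟩
      ∀ (i : Fin I.lstar) (e : Fin ((i : ℕ) + 1 + 1) → placesOver F₀ p) (b₀ : Fin ((i : ℕ) + 1 + 1)),
        ∀ ψ ∈ ind1StripOf (I.σ.lift (e b₀).1) (galoisLog (I.σ.lift (e b₀).1)), ∃ γ ∈ H ((i : ℕ) + 1) e,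
          ∀ z : ∀ b, (I.σ.localFields p).k (e b),
            (γ : PacketAlgebra p (fun b => (I.σ.localFields p).k (e b)) ≃ₗ[ℚ_[p]]
                PacketAlgebra p (fun b => (I.σ.localFields p).k (e b))) (PiTensorProduct.tprod ℚ_[p] z) =
              PiTensorProduct.tprod ℚ_[p] (update z b₀
                (RescaledCompletion.of K p (I.σ.lift (e b₀).1) (I.σ.natCast_mem_lift (e b₀))
                  (ψ ((RescaledCompletion.of K p (I.σ.lift (e b₀).1) (I.σ.natCast_mem_lift (e b₀))).symm (z b₀)))))) :
    haveI : Fact p.Prime := ⟨hp⟩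
    (I.packetAt p hp).lnνLp I.lstar (fun j e =>
        packetHull p (fun b => (I.σ.localFields p).k (e b))
          (⋃ g : H j e, (g : PacketAlgebra p (fun b => (I.σ.localFields p).k (e b)) ≃ₗ[ℚ_[p]]
              PacketAlgebra p (fun b => (I.σ.localFields p).k (e b))) ''
            ⋃ τ : Equiv.Perm (Fin (j + 1)), (I.packetAt p hp).perm τ e '' (I.packetAt p hp).pilotRegion (I.tΘ p hp) j (e ∘ τ))) =
      I.negLogThetaLoc p := by
  haveI : Fact p.Prime := ⟨hp⟩
  rw [negLogThetaLoc_of_prime I hp]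
  exact localFields_lnνLp_hull_orbitH_indOneUnion_eq_negLogThetaAt_of_bit_of_jannsenWingbergMappingClass I.σ p (mScale p (I.σ.localFields p))
    (mScale_ne_zero p (I.σ.localFields p)) (mScale_perm p (I.σ.localFields p)) hMC hp2 (I.tΘ p hp) he h3 hodd v hv a₀ ha₀ hbit H hH hstrip

end Literature.IUT.LogVolume.ThetaVolumeInput

end
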